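import Summits.Parity.GeneralizedHardyLittlewood.Theorems.LeeYangFibresRelativeDimOneTypeDefs
import Summits.Parity.GeneralizedHardyLittlewood.Theorems.LeeYangFibresRelativeDimOneSplitBandlimited
import Summits.Parity.GeneralizedHardyLittlewood.Theorems.LeeYangFibresAbsoluteUpgradeSlices
import Summits.Parity.GeneralizedHardyLittlewood.Theorems.LeeYangFibresCellParityLawSingularRatio
import Summits.Parity.GeneralizedHardyLittlewood.Theorems.LeeYangFibresRelativeDimOneSplitEulerExpansion
import Summits.Parity.GeneralizedHardyLittlewood.Theorems.LeeYangFibresRelativeDimOneSplitDictionary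
import Summits.Parity.GeneralizedHardyLittlewood.Theorems.LeeYangFibresRelativeDimOneSplitTranslation
import Summits.Parity.GeneralizedHardyLittlewood.Theorems.LeeYangFibresRelativeDimOne
import HarnessLib

/-!
# Route `LeeYangFibres`, crux `RelativeDimOne` (stmt-Parity-14113), RESHAPED line `gallagher-backwards-split`
# (type-conditioned split): the registered stub `stub_endgame` — `∀ θ, 0 < θ → θ < 1 → Endgame θ`

`Endgame θ` (vocabulary `LeeYangFibresRelativeDimOneTypeDefs`) is the pure ASSEMBLY step of the reshaped line: the crux
`RelativeDimOne` (the `Λ`-form of Green–Tao Conj. 1.4 at `d = 1`) follows from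

* the core atom `IncidenceBandlimitedCoreDecay θ` (at every large scale `N` SOME type-invariant, Hardy–Littlewood
  decaying spectrum `f` reproduces every `S(Ψ, K)` to relative accuracy `ε (β_∞ |F| + N)`, `F = sfBand ⌊N^θ⌋ (f a) b₀`),
* the type data `TypeData θ` (the type-conditioned density of `F` is the local singular factor `∏_{p ≤ w} β_p` up to
  `η G_w`),
* `TypeRigidity` ((R1) band sum `=` its `w`-smooth part, (R2) conditioned density `=` the same smooth part, both up to
  `κ G_w`, for every type-invariant decaying spectrum), and
* `SingularWeightFacts` ((W1) `G_w ≤ C_t 𝔖`, (W2) `𝔖 = 0 ⇒ S ≤ εN`, (W4) the smooth part of the explicit spectrum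
  `hlCoeff` is `∏_{p ≤ w} β_p` up to `ε`).

PROOF. Fix `t, L, ε₀` (w.l.o.g. `ε₀ ≤ 1`). Take `D` above the thresholds of `TypeData` and (W4), the core's decay
constant `C` (at the sizes `L₁ ≥ L` that `TypeData` asks for), the constant `C_w` of (W1), and `κ = ε₀ / (16 C_w)`.
For `N` large and a non-degenerate `Ψ = sys a b₀` with `‖Ψ‖_N ≤ L`, `K ⊆ [-N, N]` convex:
* if `𝔖(Ψ) = 0`, (W2) gives `0 ≤ S ≤ ε₀ N` and the claim is trivial;
* otherwise let `f` be the core's spectrum at scale `N`, `hl = hlCoeff · a ·` (type-invariant, decay `1`) and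
  `e = f a − hl` (type-invariant, decay `C + 1`). `TypeData` gives `|condSum (f a) − λ| ≤ κG` (`λ = ∏_{p ≤ w} β_p`),
  (R2) for `hl` and (W4) give `|condSum hl − λ| ≤ 2κG`, so `|condSum e| ≤ 3κG` (linearity of `condSum`); (R1), (R2) for
  `e` then give `|sfBand e| = |F − H| ≤ 5κG ≤ 5κ C_w 𝔖 = (5/16) ε₀ 𝔖` by (W1), where `H = sfBand ⌊N^θ⌋ hl b₀` is the
  truncated squarefree Euler expansion of `𝔖(Ψ)`, `|𝔖 − H| ≤ ε₀/16` by the landed uniform Euler tail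
  `BandlimitedProof.abs_sub_sum_squarefree_le`; finally the core clause at `(Ψ, K)` (accuracy `ε₀/16`) and `β_∞ ≤ 2N`
  (`archFactor_le_two_mul`) close `|S − β_∞ 𝔖| ≤ ε₀ (β_∞ 𝔖 + N)` (`EndgameProof.endgame_chain`).

References: Green–Tao, Ann. of Math. 171 (2010), Conj. 1.4 [GreenTao2010]; Gallagher, Mathematika 23 (1976) §2
[Gallagher1976].
-/

noncomputable section

open scoped BigOperators Classical
open Finset Literature.NumberTheory.Sieve
open Summit.Parity.GeneralizedHardyLittlewood.Theses.LeeYangFibres (RelativeDimOne)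
open Summit.Parity.GeneralizedHardyLittlewood.Cruxes.RelativeDimOne.GallagherBackwardsSplit
open Summit.Parity.GeneralizedHardyLittlewood.Cruxes.RelativeDimOne.GallagherBackwardsSplit.BandlimitedProof
  (abs_sub_sum_squarefree_le)
open Summit.Parity.GeneralizedHardyLittlewood.Cruxes.CellParityLaw.SectionAnnihilator.SingularRatio
  (singularProduct_nonneg)
open Summit.Parity.GeneralizedHardyLittlewood.Theorems.AbsoluteUpgrade (archFactor_le_two_mul)
open Summit.Parity.GeneralizedHardyLittlewood.Theorems.LeeYangFibresRelativeDimOne (vonMangoldtSum_nonneg)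

namespace Summit.Parity.GeneralizedHardyLittlewood.Cruxes.RelativeDimOne.TypeSplit

/-! ### Tools for the assembly -/

namespace EndgameProof

variable {t : ℕ}

/-- The singular-series spectrum `(q, b) ↦ hlCoeff q a b` is type-invariant (type factorisation of `β_p`). -/
theorem typeInvariant_hl (a : Fin t → ℤ) : TypeInvariant a (fun q b => hlCoeff q a b) := by
  intro q _ b b' h
  unfold hlCoeff
  refine Finset.prod_congr rfl fun p hp => ?_
  rw [localFactor_sys_eq_of_incType_eq p (Nat.prime_of_mem_primeFactors hp) a b b' (h p hp)]

/-- The singular-series spectrum has Hardy–Littlewood decay with constant `1`. -/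
theorem hasDecay_hl (a : Fin t → ℤ) : HasDecay 1 a (fun q b => hlCoeff q a b) := by
  intro q _ b
  unfold hlCoeff wprod wt
  rw [one_mul, Finset.abs_prod]
  refine Finset.prod_le_prod (fun p _ => abs_nonneg _) fun p _ => ?_
  have : 0 ≤ (t : ℝ) ^ 2 / (p : ℝ) ^ 2 := by positivity
  linarith

/-- The difference of two type-invariant spectra is type-invariant. -/
theorem typeInvariant_sub {a : Fin t → ℤ} {u v : ℕ → (Fin t → ℤ) → ℝ} (hu : TypeInvariant a u)
    (hv : TypeInvariant a v) : TypeInvariant a (fun q b => u q b - v q b) := by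
  intro q hq b b' h
  simp only [hu q hq b b' h, hv q hq b b' h]

/-- Decay constants add under subtraction of spectra. -/
theorem hasDecay_sub {a : Fin t → ℤ} {C C' : ℝ} {u v : ℕ → (Fin t → ℤ) → ℝ} (hu : HasDecay C a u)
    (hv : HasDecay C' a v) : HasDecay (C + C') a (fun q b => u q b - v q b) := by
  intro q hq b
  calc |u q b - v q b| ≤ |u q b| + |v q b| := abs_sub _ _
    _ ≤ C * wprod q a b + C' * wprod q a b := add_le_add (hu q hq b) (hv q hq b)
    _ = (C + C') * wprod q a b := by ring

/-- `sfBand` of a difference of spectra. -/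
theorem sfBand_sub (Q : ℕ) (u v : ℕ → (Fin t → ℤ) → ℝ) (b : Fin t → ℤ) :
    sfBand Q (fun q b => u q b - v q b) b = sfBand Q u b - sfBand Q v b := by
  unfold sfBand
  exact Finset.sum_sub_distrib _ _

/-- `condAvg` of a difference. -/
theorem condAvg_sub (q w : ℕ) (a b₀ : Fin t → ℤ) (g g' : (Fin t → ℤ) → ℝ) :
    condAvg q w a b₀ (fun b => g b - g' b) = condAvg q w a b₀ g - condAvg q w a b₀ g' := by
  unfold condAvg
  rw [Finset.sum_sub_distrib, sub_div]

/-- `condSum` of a difference of spectra. -/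
theorem condSum_sub (Q w : ℕ) (a b₀ : Fin t → ℤ) (u v : ℕ → (Fin t → ℤ) → ℝ) :
    condSum Q w a b₀ (fun q b => u q b - v q b) = condSum Q w a b₀ u - condSum Q w a b₀ v := by
  unfold condSum
  rw [← Finset.sum_sub_distrib]
  exact Finset.sum_congr rfl fun q _ => condAvg_sub q w a b₀ (u q) (v q)

/-- The smooth scale is at least `1` (a product of factors `1 + wt ≥ 1`). -/
theorem one_le_gscale (w : ℕ) (a b : Fin t → ℤ) : 1 ≤ gscale w a b := by
  unfold gscale
  calc (1 : ℝ) = ∏ _p ∈ Nat.primesLE w, (1 : ℝ) := Finset.prod_const_one.symm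
    _ ≤ ∏ p ∈ Nat.primesLE w, (1 + wt a b p) :=
        Finset.prod_le_prod (fun _ _ => zero_le_one) fun p _ => by
          have : 0 ≤ wt a b p := by unfold wt; positivity
          linarith

/-- The core's approximation clause is monotone in the accuracy `ε`. -/
theorem coreApprox_mono {θ : ℝ} {t L N : ℕ} {ε ε' : ℝ} (h : ε ≤ ε')
    {f : (Fin t → ℤ) → ℕ → (Fin t → ℤ) → ℝ} (hf : CoreApprox θ t L N ε f) : CoreApprox θ t L N ε' f := by
  intro Ψ hΨ hL K hK hKN
  refine (hf Ψ hΨ hL K hK hKN).trans ?_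
  have hA : 0 ≤ archFactor Ψ K := ENNReal.toReal_nonneg
  exact mul_le_mul_of_nonneg_right h (by positivity)

/-- Coefficient and shift bounds of a non-degenerate `sys a b` with `‖sys a b‖_N ≤ L`, `N ≥ 1`: every `a_i ≠ 0`,
`|a_i| ≤ L`, `|b_i| ≤ L N`. -/
theorem coeff_bounds {a b : Fin t → ℤ} {N L : ℕ} (hN : 1 ≤ N) (hnd : IsNondegenerateSystem (sys a b))
    (hL : affLinSize (sys a b) N ≤ L) :
    (∀ i, a i ≠ 0 ∧ |a i| ≤ L) ∧ (∀ i, |b i| ≤ L * N) := by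
  rw [affLinSize_sys] at hL
  have ha0 := ((isNondegenerateSystem_sys_iff a b).mp hnd).1
  have hNpos : (0 : ℝ) < N := by exact_mod_cast hN
  have hsum1 : 0 ≤ ∑ i, |(a i : ℝ)| := Finset.sum_nonneg fun i _ => abs_nonneg _
  have hsum2 : 0 ≤ ∑ i, |(b i : ℝ) / N| := Finset.sum_nonneg fun i _ => abs_nonneg _
  refine ⟨fun i => ⟨ha0 i, ?_⟩, fun i => ?_⟩
  · have h1 : |(a i : ℝ)| ≤ ∑ j, |(a j : ℝ)| :=
      Finset.single_le_sum (f := fun j => |(a j : ℝ)|) (fun j _ => abs_nonneg _) (Finset.mem_univ i)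
    have h2 : |(a i : ℝ)| ≤ L := by linarith
    exact_mod_cast h2
  · have h1 : |(b i : ℝ) / N| ≤ ∑ j, |(b j : ℝ) / N| :=
      Finset.single_le_sum (f := fun j => |(b j : ℝ) / N|) (fun j _ => abs_nonneg _) (Finset.mem_univ i)
    have h2 : |(b i : ℝ) / N| ≤ L := by linarith
    rw [abs_div, abs_of_pos hNpos, div_le_iff₀ hNpos] at h2
    exact_mod_cast h2

/-- **The real-arithmetic endgame chain**: from the core clause `|S − A F| ≤ η (A |F| + N)`, the rigidity output
`|F − H| ≤ 5 η 𝔖`, the Euler tail `|𝔖 − H| ≤ η`, and `0 ≤ A ≤ 2N`, `𝔖 ≥ 0`, `η ≤ 1/16`: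
`|S − A 𝔖| ≤ 16 η (A 𝔖 + N)`. -/
theorem endgame_chain {S A F H 𝔖 N η : ℝ} (hA0 : 0 ≤ A) (hA2 : A ≤ 2 * N) (hS0 : 0 ≤ 𝔖) (hN : 0 ≤ N)
    (hη0 : 0 ≤ η) (hη : η ≤ 1 / 16)
    (hcore : |S - A * F| ≤ η * (A * |F| + N)) (hFH : |F - H| ≤ 5 * η * 𝔖) (hH : |𝔖 - H| ≤ η) :
    |S - A * 𝔖| ≤ 16 * η * (A * 𝔖 + N) := by
  -- `|F − 𝔖| ≤ 5η𝔖 + η` and `|F| ≤ 𝔖 + 5η𝔖 + η`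
  have hF𝔖 : |F - 𝔖| ≤ 5 * η * 𝔖 + η := by
    calc |F - 𝔖| = |(F - H) + (H - 𝔖)| := by ring_nf
      _ ≤ |F - H| + |H - 𝔖| := abs_add_le _ _
      _ ≤ 5 * η * 𝔖 + η := by rw [abs_sub_comm H 𝔖]; exact add_le_add hFH hH
  have hFabs : |F| ≤ 𝔖 + (5 * η * 𝔖 + η) := by
    calc |F| = |𝔖 + (F - 𝔖)| := by ring_nf
      _ ≤ |𝔖| + |F - 𝔖| := abs_add_le _ _
      _ ≤ 𝔖 + (5 * η * 𝔖 + η) := by rw [abs_of_nonneg hS0]; exact add_le_add le_rfl hF𝔖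
  -- split `S − A𝔖 = (S − AF) + A(F − 𝔖)`
  have h1 : |S - A * 𝔖| ≤ |S - A * F| + A * |F - 𝔖| := by
    calc |S - A * 𝔖| = |(S - A * F) + A * (F - 𝔖)| := by ring_nf
      _ ≤ |S - A * F| + |A * (F - 𝔖)| := abs_add_le _ _
      _ = |S - A * F| + A * |F - 𝔖| := by rw [abs_mul, abs_of_nonneg hA0]
  have h2 : A * |F - 𝔖| ≤ A * (5 * η * 𝔖 + η) := mul_le_mul_of_nonneg_left hF𝔖 hA0
  have h3 : A * |F| ≤ A * (𝔖 + (5 * η * 𝔖 + η)) := mul_le_mul_of_nonneg_left hFabs hA0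
  have h4 : η * (A * |F| + N) ≤ η * (A * (𝔖 + (5 * η * 𝔖 + η)) + N) :=
    mul_le_mul_of_nonneg_left (by linarith) hη0
  -- the quadratic terms: `η² ≤ η / 16`
  have hη2 : η * η ≤ η * (1 / 16) := mul_le_mul_of_nonneg_left hη hη0
  have hAS0 : 0 ≤ A * 𝔖 := mul_nonneg hA0 hS0
  have h5 : η * η * (A * 𝔖) ≤ η * (1 / 16) * (A * 𝔖) := mul_le_mul_of_nonneg_right hη2 hAS0
  have h6 : η * η * A ≤ η * (1 / 16) * A := mul_le_mul_of_nonneg_right hη2 hA0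
  have h7 : η * A ≤ η * (2 * N) := mul_le_mul_of_nonneg_left hA2 hη0
  have h8 : 0 ≤ η * (A * 𝔖) := mul_nonneg hη0 hAS0
  have h9 : 0 ≤ η * N := mul_nonneg hη0 hN
  calc |S - A * 𝔖| ≤ |S - A * F| + A * |F - 𝔖| := h1
    _ ≤ η * (A * (𝔖 + (5 * η * 𝔖 + η)) + N) + A * (5 * η * 𝔖 + η) := by linarith
    _ ≤ 16 * η * (A * 𝔖 + N) := by nlinarith [h5, h6, h7, h8, h9]

end EndgameProof

open EndgameProof

/-! ### The stub -/

/-- **`stub_endgame`** (registered stub of the reshaped line `gallagher-backwards-split`, type split): for every level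
`0 < θ < 1`, the core with decay `IncidenceBandlimitedCoreDecay θ`, the type data `TypeData θ`, `TypeRigidity` and
`SingularWeightFacts` together imply the crux `RelativeDimOne`. Pure assembly: pick `D` above the thresholds of
`TypeData` and (W4); (W2) settles `𝔖(Ψ) = 0`; otherwise with `e = f a − hlCoeff · a ·` (type-invariant, decay `C + 1`)
`TypeData` + (R2 for `hlCoeff`) + (W4) bound `|condSum e| ≤ 3κ G_w`, (R1), (R2) give
`|sfBand (f a) b₀ − sfBand (hl a) b₀| ≤ 5κ G_w ≤ 5κ C_w 𝔖(Ψ)` (W1), the uniform Euler tail `abs_sub_sum_squarefree_le`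
gives `|𝔖(Ψ) − sfBand (hl a) b₀| ≤ ε₀/16`, and the core clause at `(Ψ, K)` with `β_∞ ≤ 2N` closes
`|S − β_∞ 𝔖| ≤ ε₀ (β_∞ 𝔖 + N)`. [cite: GreenTao2010, Conj. 1.4] -/
theorem stub_endgame : ∀ θ : ℝ, 0 < θ → θ < 1 → Endgame θ := by
  intro θ hθ0 _ hCore hData hRig hW t L ht ε₀' hε₀'
  obtain ⟨hW1, hW2, hW4, -⟩ := hW
  -- w.l.o.g. `ε₀ ≤ 1`
  obtain ⟨ε₀, hε₀def⟩ : ∃ ε₀ : ℝ, ε₀ = min ε₀' 1 := ⟨_, rfl⟩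
  have hε₀ : 0 < ε₀ := by rw [hε₀def]; exact lt_min hε₀' one_pos
  have hε₀1 : ε₀ ≤ 1 := by rw [hε₀def]; exact min_le_right _ _
  have hε₀le : ε₀ ≤ ε₀' := by rw [hε₀def]; exact min_le_left _ _
  -- the constants `D`, `L₁`, `C`, `C_w`, `κ`
  obtain ⟨D₁, L₁, hLL₁, hData'⟩ := hData t L ht
  obtain ⟨D₂, hW4'⟩ := hW4 t L θ hθ0
  obtain ⟨C, hC, hCore'⟩ := hCore t L₁ ht
  obtain ⟨Cw, hCw, hW1'⟩ := hW1 t ht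
  obtain ⟨D, hDdef⟩ : ∃ D : ℕ, D = max (max D₁ D₂) 1 := ⟨_, rfl⟩
  have hD1 : 1 ≤ D := by omega
  have hDD₁ : D₁ ≤ D := by omega
  have hDD₂ : D₂ ≤ D := by omega
  obtain ⟨κ, hκdef⟩ : ∃ κ : ℝ, κ = ε₀ / (16 * Cw) := ⟨_, rfl⟩
  have hκ : 0 < κ := by rw [hκdef]; positivity
  have hκCw : κ * Cw = ε₀ / 16 := by
    rw [hκdef]
    field_simp
  have hC1 : 0 < C + 1 := by linarith
  have hη : 0 < ε₀ / 16 := by positivity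
  -- the thresholds
  obtain ⟨N₁, hR⟩ := hRig t L D (C + 1) κ ht hD1 hC1 hκ
  obtain ⟨N₁', hR'⟩ := hRig t L D 1 κ ht hD1 one_pos hκ
  obtain ⟨ε₁, hε₁, N₂, hD'⟩ := hData' D hDD₁ C κ hC hκ
  obtain ⟨N₃, hW4''⟩ := hW4' D hDD₂ κ hκ
  obtain ⟨N₄, hW2'⟩ := hW2 t L ht ε₀ hε₀
  obtain ⟨N₅, hSSB⟩ := abs_sub_sum_squarefree_le t L hθ0 hη
  have hε' : 0 < min ε₁ (ε₀ / 16) := lt_min hε₁ hη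
  obtain ⟨N₆, hCore''⟩ := hCore' (min ε₁ (ε₀ / 16)) hε'
  refine ⟨max 1 (max N₁ (max N₁' (max N₂ (max N₃ (max N₄ (max N₅ N₆)))))),
    fun N hN Ψ hΨ hL K hK hKN => ?_⟩
  simp only [max_le_iff] at hN
  obtain ⟨hN1, hNN₁, hNN₁', hNN₂, hNN₃, hNN₄, hNN₅, hNN₆⟩ := hN
  -- `Ψ = sys a b₀`
  obtain ⟨a, b₀, rfl⟩ : ∃ a b₀, Ψ = sys a b₀ := ⟨coeffs Ψ, consts Ψ, (sys_coeffs_consts Ψ).symm⟩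
  have hN0 : (0 : ℝ) ≤ N := Nat.cast_nonneg N
  have hA0 : 0 ≤ archFactor (sys a b₀) K := ENNReal.toReal_nonneg
  have hA2 : archFactor (sys a b₀) K ≤ 2 * (N : ℝ) := archFactor_le_two_mul _ hKN
  have hS0 : 0 ≤ singularProduct (sys a b₀) := singularProduct_nonneg hΨ
  have hSv0 : 0 ≤ vonMangoldtSum (sys a b₀) K N := vonMangoldtSum_nonneg _ K N
  have htarget0 : 0 ≤ archFactor (sys a b₀) K * singularProduct (sys a b₀) + N := by positivity
  rcases eq_or_ne (singularProduct (sys a b₀)) 0 with h𝔖 | h𝔖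
  · -- local obstruction: (W2) and `S ≥ 0`
    have hobs := hW2' N hNN₄ (sys a b₀) hΨ hL h𝔖 K hKN
    rw [h𝔖, mul_zero, sub_zero, zero_add, abs_of_nonneg hSv0]
    exact hobs.trans (mul_le_mul_of_nonneg_right hε₀le hN0)
  -- the main case `𝔖(Ψ) > 0`: sizes of `a`, `b₀`, and the core's spectrum `f` at scale `N`
  obtain ⟨ha, hb⟩ := coeff_bounds hN1 hΨ hL
  obtain ⟨f, hInv, hDec, hApprox⟩ := hCore'' N hNN₆
  -- (TypeData) for `f a`
  have h1 : |condSum (level θ N) (wlev D N) a b₀ (f a) - singularProductPartial (sys a b₀) (wlev D N)|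
      ≤ κ * gscale (wlev D N) a b₀ :=
    hD' N hNN₂ f hInv hDec (coreApprox_mono (min_le_left _ _) hApprox) a b₀ ha hb hΨ
  -- (R2) for the explicit spectrum `hl`
  have h2 : |condSum (level θ N) (wlev D N) a b₀ (fun q b => hlCoeff q a b)
        - smoothBand (level θ N) (wlev D N) (fun q b => hlCoeff q a b) b₀| ≤ κ * gscale (wlev D N) a b₀ :=
    (hR' N hNN₁' (level θ N) a ha _ (typeInvariant_hl a) (hasDecay_hl a) b₀ hb hΨ).2.1
  -- (W4)
  have h3 : |smoothBand (level θ N) (wlev D N) (fun q b => hlCoeff q a b) b₀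
        - singularProductPartial (sys a b₀) (wlev D N)| ≤ κ := hW4'' N hNN₃ a b₀ ha
  -- (R1), (R2) for `e = f a - hl` (type-invariant, decay `C + 1`), with `sfBand`, `condSum` expanded linearly
  have hRe := hR N hNN₁ (level θ N) a ha _ (typeInvariant_sub (hInv a) (typeInvariant_hl a))
    (hasDecay_sub (hDec a) (hasDecay_hl a)) b₀ hb hΨ
  have h4 : |sfBand (level θ N) (f a) b₀ - sfBand (level θ N) (fun q b => hlCoeff q a b) b₀
        - smoothBand (level θ N) (wlev D N) (fun q b => f a q b - hlCoeff q a b) b₀|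
      ≤ κ * gscale (wlev D N) a b₀ := by
    have := hRe.1
    rwa [sfBand_sub] at this
  have h5 : |condSum (level θ N) (wlev D N) a b₀ (f a) - condSum (level θ N) (wlev D N) a b₀ (fun q b => hlCoeff q a b)
        - smoothBand (level θ N) (wlev D N) (fun q b => f a q b - hlCoeff q a b) b₀|
      ≤ κ * gscale (wlev D N) a b₀ := by
    have := hRe.2.1
    rwa [condSum_sub] at this
  -- (W1): `κ G ≤ κ C_w 𝔖 = (ε₀/16) 𝔖`, and `κ ≤ κ G`
  have hG1 := one_le_gscale (wlev D N) a b₀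
  have hGW : gscale (wlev D N) a b₀ ≤ Cw * singularProduct (sys a b₀) := hW1' (wlev D N) a b₀ hΨ h𝔖
  have hκG : κ * gscale (wlev D N) a b₀ ≤ ε₀ / 16 * singularProduct (sys a b₀) := by
    calc κ * gscale (wlev D N) a b₀ ≤ κ * (Cw * singularProduct (sys a b₀)) :=
          mul_le_mul_of_nonneg_left hGW hκ.le
      _ = (κ * Cw) * singularProduct (sys a b₀) := by ring
      _ = ε₀ / 16 * singularProduct (sys a b₀) := by rw [hκCw]
  have hκ1 : κ ≤ κ * gscale (wlev D N) a b₀ := le_mul_of_one_le_right hκ.le hG1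
  -- hence `|F - H| ≤ 5 κ G ≤ 5 (ε₀/16) 𝔖`
  have hFH : |sfBand (level θ N) (f a) b₀ - sfBand (level θ N) (fun q b => hlCoeff q a b) b₀|
      ≤ 5 * (ε₀ / 16) * singularProduct (sys a b₀) := by
    rw [abs_le] at h1 h2 h3 h4 h5 ⊢
    obtain ⟨h1l, h1r⟩ := h1
    obtain ⟨h2l, h2r⟩ := h2
    obtain ⟨h3l, h3r⟩ := h3
    obtain ⟨h4l, h4r⟩ := h4
    obtain ⟨h5l, h5r⟩ := h5
    constructor <;> linarith
  -- the uniform Euler tail: `|𝔖 - H| ≤ ε₀/16`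
  have h6 : |singularProduct (sys a b₀) - sfBand (level θ N) (fun q b => hlCoeff q a b) b₀| ≤ ε₀ / 16 :=
    (hSSB N hNN₅ (sys a b₀) hΨ hL).2
  -- the core clause at `(Ψ, K)` with accuracy `ε₀/16`
  have hL₁ : affLinSize (sys a b₀) N ≤ L₁ := hL.trans (by exact_mod_cast hLL₁)
  have h7 := hApprox (sys a b₀) hΨ hL₁ K hK hKN
  rw [coeffs_sys, consts_sys] at h7
  have h7' : |vonMangoldtSum (sys a b₀) K N - archFactor (sys a b₀) K * sfBand (level θ N) (f a) b₀|
      ≤ ε₀ / 16 * (archFactor (sys a b₀) K * |sfBand (level θ N) (f a) b₀| + N) :=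
    h7.trans (mul_le_mul_of_nonneg_right (min_le_right _ _) (by positivity))
  have hη16 : ε₀ / 16 ≤ 1 / 16 := by linarith [hε₀1]
  -- the chain
  calc |vonMangoldtSum (sys a b₀) K N - archFactor (sys a b₀) K * singularProduct (sys a b₀)|
      ≤ 16 * (ε₀ / 16) * (archFactor (sys a b₀) K * singularProduct (sys a b₀) + N) :=
        endgame_chain hA0 hA2 hS0 hN0 hη.le hη16 h7' hFH h6
    _ = ε₀ * (archFactor (sys a b₀) K * singularProduct (sys a b₀) + N) := by ring
    _ ≤ ε₀' * (archFactor (sys a b₀) K * singularProduct (sys a b₀) + N) :=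
        mul_le_mul_of_nonneg_right hε₀le htarget0

end Summit.Parity.GeneralizedHardyLittlewood.Cruxes.RelativeDimOne.TypeSplit

end
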